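import Summits.Ventures.Crystal3D.Theorems.StickyWulffConstantGenericWallFloorRayAlignedWord
import Summits.Ventures.Crystal3D.Theorems.StickyWulffConstantGenericWallFloorRayWordFar
import HarnessLib

/-!
# The inverse word: `A₂·Λ₀ = (wordFrame A₁ κ)·Λ₀` read from grain 2

HONEST FRAMING. Part of the venture `Summits/Ventures/Crystal3D` (cell `crystal3d-full`), helper `--supports` the
crux `GenericWallFloor` (stmt-Ventures-19480) of `route-Ventures-StickyWulffConstant`, registered line `WallLedgerG`,
open stub `stub_twoSlabAdhesion`; serves the planner's closer (γ) for the deep-arrival tail (cf-p1 ruling 2026-08-29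
00:18Z): a pair is priced from grain 2's one-sided DOWN family unless it is a MUTUAL arrival, and that family's `hfar`
(`image_ne_of_rayWord_ne` applied to grain 2) needs the word presenting `A₁·Λ₀` OVER `A₂`.

* **`exists_inverse_word`** — if `A₂·Λ₀ = (wordFrame A₁ κ)·Λ₀` with unit model menu letters, then
  `A₁·Λ₀ = (wordFrame A₂ κ')·Λ₀` for `κ' = κ.reverse.map S`, `S` a symmetry of `Λ₀` (`exists_transport_of_image_eq`);
  `κ'` has unit model menu letters, the same length, and is reduced when `κ` is.

WHAT THIS IS NOT: not the stub; F-C1 not moved.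
-/

noncomputable section

namespace Summit.Ventures.Crystal3D.Theorems

open Summit.Ventures.Crystal3D Finset
open Literature.MathematicalPhysics.StatisticalMechanics (fccStacking)
open scoped InnerProductSpace

/-- **The inverse word.**  See the module docstring. -/
theorem exists_inverse_word {A₁ A₂ : EuclideanSpace ℝ (Fin 3) ≃ₗᵢ[ℝ] EuclideanSpace ℝ (Fin 3)}
    {κ : List (EuclideanSpace ℝ (Fin 3))}
    (hκl : ∀ μ ∈ κ, ‖μ‖ = 1 ∧
      ∀ w ∈ fccSlots, ⟪w, μ⟫_ℝ = 0 ∨ ⟪w, μ⟫_ℝ = Real.sqrt (2 / 3) ∨ ⟪w, μ⟫_ℝ = -Real.sqrt (2 / 3))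
    (hA₂ : A₂ '' fccStacking 1 (Real.sqrt (2 / 3)) = (wordFrame A₁ κ) '' fccStacking 1 (Real.sqrt (2 / 3))) :
    ∃ (S : EuclideanSpace ℝ (Fin 3) ≃ₗᵢ[ℝ] EuclideanSpace ℝ (Fin 3)),
      S '' fccStacking 1 (Real.sqrt (2 / 3)) = fccStacking 1 (Real.sqrt (2 / 3)) ∧
      (∀ x, wordFrame A₂ (κ.reverse.map S) (S x) = A₁ x) ∧
      A₁ '' fccStacking 1 (Real.sqrt (2 / 3)) =
        (wordFrame A₂ (κ.reverse.map S)) '' fccStacking 1 (Real.sqrt (2 / 3)) ∧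
      (∀ μ ∈ κ.reverse.map S, ‖μ‖ = 1 ∧
        ∀ w ∈ fccSlots, ⟪w, μ⟫_ℝ = 0 ∨ ⟪w, μ⟫_ℝ = Real.sqrt (2 / 3) ∨ ⟪w, μ⟫_ℝ = -Real.sqrt (2 / 3)) ∧
      (κ.reverse.map S).length = κ.length ∧
      (List.IsChain (fun μ μ' => ⟪μ, μ'⟫_ℝ = 1 / 3 ∨ ⟪μ, μ'⟫_ℝ = -1 / 3) κ →
        List.IsChain (fun μ μ' => ⟪μ, μ'⟫_ℝ = 1 / 3 ∨ ⟪μ, μ'⟫_ℝ = -1 / 3) (κ.reverse.map S)) := by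
  -- `F₂ := wordFrame A₁ κ` is a word frame over `A₁` whose lattice is `A₂`'s: transport with `W := A₂`
  obtain ⟨S, hS, hSx, himg, hletters⟩ :=
    exists_transport_of_image_eq (A₂ := A₁) (F₂ := wordFrame A₁ κ) (W := A₂) rfl hκl hA₂.symm
  exact ⟨S, hS, hSx, himg, hletters, by rw [List.length_map, List.length_reverse], fun hc => isChain_reverse_map S hc⟩

/-- **`hfar` for grain 2's DOWN family from grain 2's ray words** (closer (γ)): if `A₂·Λ₀ = (wordFrame A₁ κ)·Λ₀`
(`κ ≠ []` reduced admissible) and, for the inverse word `κ'` over `A₂` and both admissible first push normals of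
`(A₂, u₂)`, the depth-`|κ|` ray word of grain 2 is not `κ'`, then no frame of a sound well-formed `z`-stack over
`(A₂, u₂, 0)` carries `A₁·Λ₀` — the pair is not an arrival FROM grain 2. -/
theorem image_ne_of_inverse_rayWord_ne {A₁ A₂ : EuclideanSpace ℝ (Fin 3) ≃ₗᵢ[ℝ] EuclideanSpace ℝ (Fin 3)}
    {u₂ z : EuclideanSpace ℝ (Fin 3)} {κ : List (EuclideanSpace ℝ (Fin 3))}
    (hκl : ∀ μ ∈ κ, ‖μ‖ = 1 ∧
      ∀ w ∈ fccSlots, ⟪w, μ⟫_ℝ = 0 ∨ ⟪w, μ⟫_ℝ = Real.sqrt (2 / 3) ∨ ⟪w, μ⟫_ℝ = -Real.sqrt (2 / 3))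
    (hκc : List.IsChain (fun μ μ' => ⟪μ, μ'⟫_ℝ = 1 / 3 ∨ ⟪μ, μ'⟫_ℝ = -1 / 3) κ) (hκ : κ ≠ [])
    (hA₂ : A₂ '' fccStacking 1 (Real.sqrt (2 / 3)) = (wordFrame A₁ κ) '' fccStacking 1 (Real.sqrt (2 / 3)))
    (hray : ∀ (S : EuclideanSpace ℝ (Fin 3) ≃ₗᵢ[ℝ] EuclideanSpace ℝ (Fin 3)),
      S '' fccStacking 1 (Real.sqrt (2 / 3)) = fccStacking 1 (Real.sqrt (2 / 3)) →
      A₁ '' fccStacking 1 (Real.sqrt (2 / 3)) =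
        (wordFrame A₂ (κ.reverse.map S)) '' fccStacking 1 (Real.sqrt (2 / 3)) →
      ∀ n : EuclideanSpace ℝ (Fin 3), ‖n‖ = 1 →
        (∀ w ∈ fccSlots, ⟪A₂ w, n⟫_ℝ = 0 ∨ ⟪A₂ w, n⟫_ℝ = Real.sqrt (2 / 3) ∨ ⟪A₂ w, n⟫_ℝ = -Real.sqrt (2 / 3)) →
        ⟪A₂ u₂, n⟫_ℝ = Real.sqrt (2 / 3) →
        (rayWord z ⟨A₂, u₂, 0⟩ n κ.length).map (fun μ => (ℝ ∙ μ)ᗮ.reflection) ≠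
          (κ.reverse.map S).map (fun μ => (ℝ ∙ μ)ᗮ.reflection)) :
    ∀ stk : List WalkEntry, StackSound z stk → StackWF z stk → stk.getLast? = some ⟨A₂, u₂, 0⟩ →
      ∀ e ∈ stk, e.frame '' fccStacking 1 (Real.sqrt (2 / 3)) ≠ A₁ '' fccStacking 1 (Real.sqrt (2 / 3)) := by
  obtain ⟨S, hS, -, himg, hletters, hlen, hchain⟩ := exists_inverse_word hκl hA₂
  have hκ' : κ.reverse.map S ≠ [] := by
    intro h; apply hκ
    have := congrArg List.length h
    rw [hlen, List.length_nil] at this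
    exact List.eq_nil_of_length_eq_zero this
  have h := image_ne_of_rayWord_ne (z := z) (u := u₂) (κ.reverse.map S) hletters (hchain hκc) hκ' himg
    (fun n hn hm hp => by rw [hlen]; exact hray S hS himg n hn hm hp)
  exact h

end Summit.Ventures.Crystal3D.Theorems

end
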